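import Summits.BirchSwinnertonDyer.Rank1Residual.ManinAdditive.ThetaFourBrandtDegreeLawAtNine
import HarnessLib
import HarnessLib.Audit.Tags

/-!
# The θ₄-BRANDT degree law at `9 ∥ N`, part 2: kernel certificates (99a1/99c1, 153a1/153d1) and the `Iₙ*` stratum — row E-desc-124
# (cell `bsd-f2-manin`, desc g18, MEMO-desc §39; nothing asserted)

TYPER NOTE (typer g18, T-desc-32, part 2 of 2).  = §4–§5 of HOME/desc/g18/Sketch-desc-g18b.lean sha16 8b3a4d5945ef2654 VERBATIM (split from
`ThetaFourBrandtDegreeLawAtNine.lean` only because of the 400-line cap on theorem-bearing statement files; same namespace; the module docstring,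
definitions, row E-desc-123 and the honest-framing block live in part 1).  §4: structure lemmas (`ZI.iPowMul_zero/two`, unit and norm-shell counts,
`theta4Exp_unit_even`, `isThetaFourEquivariant_conj` = the Brandt side of the `χ₋₃`-twist) and `decide +kernel` certificates of θ₄-equivariance,
Hecke eigen-ness, height and sign for `m_E` at 99a1 / 99c1 (`p = 11`, `t₂ = 1`) and 153a1 / 153d1 (`p = 17`, `t₂ = 0`), each with its instance
of the LAW E-desc-123.  §5: the `θ₄² = η₃ ∘ Nrd` module (`IsUnitInvariant3`, twisted Hecke operators `thetaFourSqHecke12`,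
`IsThetaFourSqHeckeEigen`), row **E-desc-124** `ThetaFourSqBrandtDegreeLawAtNinePrime` (`@[conjecture]` node; LAW with an Eisenstein square
`m ∈ {1,…,5}`; census 971/971 optimal `Iₙ*` curves `9 ∥ N ≤ 9999`, prime level 206/206) and certificates 171d1 (`m = 1`) / 99b1 (`m = 2`).
REFUTER VERDICTS: R-desc-30 PENDING; ref2 PENDING.  PARTITION currency: 0; beyond-print theorem: NO; bears_on: stmt-BirchSwinnertonDyer-22968.
BSD is not proved by this; Manin's conjecture is not proved; C2/C3 OPEN.
[cite: CremonaEcdata] [cite: Takahashi2001, Thm. 2.3 (shape of E-desc-124 only; see its docstring)]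
-/


namespace Summit.BirchSwinnertonDyer.Rank1Residual.ManinAdditive.ThetaFourBrandt


open scoped MatrixGroups ModularForm
open CongruenceSubgroup WeierstrassCurve Literature.NumberTheory.EllipticCurves.ModularForms
open Summit.BirchSwinnertonDyer.Rank1Residual.ManinAdditive.ConwayCut (HasRationalTwoTorsion)
open Summit.BirchSwinnertonDyer.Rank1Residual.ManinAdditive.HurwitzBrandt (DQuat toPoint)
open Summit.BirchSwinnertonDyer.Rank1Residual.ManinAdditive.ThetaBrandt (tamagawaAt)

/-! ### §4. Structure lemmas and kernel certificates at the witness levels `p = 11` (99a1 / 99c1, `t₂ = 1`) and `p = 17`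
(153a1 / 153d1, `t₂ = 0`) -/

/-- `i⁰ · z = z`. -/
theorem ZI.iPowMul_zero (z : ZI) : ZI.iPowMul 0 z = z := rfl

/-- `i² · z = −z`. -/
theorem ZI.iPowMul_two (z : ZI) : ZI.iPowMul 2 z = (-z.1, -z.2) := rfl

/-- there are 12 units. -/
theorem length_dicyclicUnits : dicyclicUnits.length = 12 := by decide +kernel

/-- `#{γ ∈ O : Nrd γ = 2} = 36 = 12·3` and `#{Nrd γ = 5} = 72 = 12·6`. -/
theorem length_dicyclicOfNorm_two_five : (dicyclicOfNorm 2).length = 36 ∧ (dicyclicOfNorm 5).length = 72 := by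
  constructor <;> decide +kernel

/-- `θ₄` takes only the values `±1` on the units (`θ̃₄ ∈ {0, 2}`; six of each). -/
theorem theta4Exp_unit_even : ∀ u ∈ dicyclicUnits, theta4Exp u = 0 ∨ theta4Exp u = 2 := by decide +kernel

/-- COMPLEX CONJUGATION preserves `𝓜_θ₄(p)` (the units only see `θ₄ = ±1`).  With `conj θ₄(γ) = θ₄(γ)·η₃(Nrd γ)` this is the
Brandt side of the `χ₋₃`-TWIST: `conj m_E` is the eigenvector of `E ⊗ χ₋₃` (eigenvalues `χ₋₃(ℓ) a_ℓ`), so twins have equal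
heights and equal signs `s₃` (census 174/174; anchors `g99c_eq_conj`, `g153d_eq_conj`). [folklore] -/
theorem isThetaFourEquivariant_conj {p : ℕ} {g : Fin (p + 1) → ZI} (h : IsThetaFourEquivariant p g) :
    IsThetaFourEquivariant p (fun x => ZI.conj (g x)) := by
  intro u hu x
  have hx := h u hu x
  rcases theta4Exp_unit_even u hu with he | he <;> rw [he] at hx ⊢
  · rw [ZI.iPowMul_zero] at hx ⊢
    simp only [hx]
  · rw [ZI.iPowMul_two] at hx ⊢
    simp only [ZI.conj, ← hx, neg_neg]

/-- the embedding datum at `p = 11`: `2² + 2² + 3 = 11`. -/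
theorem negThreeAsSumOfTwoSquares_eleven : negThreeAsSumOfTwoSquares 11 = (2, 2) := by decide +kernel

/-- `m_E` for `E = 99a1` (`[1,−1,1,−2,0]`, III at 3, `E(ℚ)[2] ≠ 0`, `p = 11 ≡ 3 (mod 4)`, `c₁₁ = 1`: `t₂ = 1`; `deg φ = 4`) on
`ℙ¹(𝔽₁₁) = Fin 12` (ported by `leanport3.py` in this file's conventions). -/
def g99a : Fin 12 → ZI :=
  ![(0, -1), (1, 0), (-1, 0), (0, -1), (-1, 0), (1, 0), (0, 1), (0, 1), (1, 0), (0, -1), (-1, 0), (0, 1)]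

/-- `m_E` for the twin `E ⊗ χ₋₃ = 99c1` (`[1,−1,0,−15,8]`, III* at 3, `t₂ = 1`; `deg φ = 12`). -/
def g99c : Fin 12 → ZI :=
  ![(0, 1), (1, 0), (-1, 0), (0, 1), (-1, 0), (1, 0), (0, -1), (0, -1), (1, 0), (0, 1), (-1, 0), (0, -1)]

/-- θ₄-equivariance of `g99a` (kernel certificate over the 12 units × 12 points). -/
theorem g99a_isThetaFourEquivariant : IsThetaFourEquivariant 11 g99a := by
  unfold IsThetaFourEquivariant; decide +kernel

/-- all stabiliser weights on `ℙ¹(𝔽₁₁)` are `1`: `W g = g`. -/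
theorem g99a_weightMul : ∀ x : Fin 12, weightMul3 11 g99a x = g99a x := by decide +kernel

/-- `T₁₂,₂ g = 12·a₂·g` with `a₂(99a1) = −1` (the 36 elements of norm 2). -/
theorem g99a_hecke_two : ∀ x : Fin 12, thetaFourHecke12 11 2 g99a x = (12 * (-1) * (g99a x).1, 12 * (-1) * (g99a x).2) := by
  decide +kernel

/-- `T₁₂,₅ g = 12·a₅·g` with `a₅(99a1) = −4` (the 72 elements of norm 5). -/
theorem g99a_hecke_five : ∀ x : Fin 12, thetaFourHecke12 11 5 g99a x = (12 * (-4) * (g99a x).1, 12 * (-4) * (g99a x).2) := by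
  decide +kernel

/-- `6⟨m, m⟩ = 12`, i.e. `ξ_θ₄(99a1) = 2`; the LAW at 99a1: `3 · 2¹ · 4 = 24 = 2 · 3⁰ · 12`. -/
theorem g99a_height : thetaFourHeightSix 11 g99a = 12 ∧ (3 * 2 ^ 1 * 4 : ℤ) = 2 * 3 ^ 0 * 12 := by
  constructor <;> decide +kernel

/-- the twin vector is the complex conjugate: `m_{99c1} = conj m_{99a1}`; its Hecke eigenvalues are the `χ₋₃`-twisted ones
(`a₂ = +1`, `a₅ = +4`); the LAW at 99c1: `3 · 2¹ · 12 = 72 = 2 · 3¹ · 12`. -/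
theorem g99c_eq_conj : (∀ x : Fin 12, g99c x = ZI.conj (g99a x)) ∧
    (∀ x : Fin 12, thetaFourHecke12 11 2 g99c x = (12 * 1 * (g99c x).1, 12 * 1 * (g99c x).2)) ∧
    (∀ x : Fin 12, thetaFourHecke12 11 5 g99c x = (12 * 4 * (g99c x).1, 12 * 4 * (g99c x).2)) ∧
    (3 * 2 ^ 1 * 12 : ℤ) = 2 * 3 ^ 1 * 12 := by
  refine ⟨?_, ?_, ?_, ?_⟩ <;> decide +kernel

/-- the sign: `ι₃ m = ζ m` with `ζ(99a1) = −i`, `ζ(99c1) = +i` (`s₃ = ζ² = −1` for both twins). -/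
theorem g99_iota : (∀ x : Fin 12, thetaFourIota 11 g99a x = ZI.mul (0, -1) (g99a x)) ∧
    (∀ x : Fin 12, thetaFourIota 11 g99c x = ZI.mul (0, 1) (g99c x)) := by
  constructor <;> decide +kernel

/-- the embedding datum at `p = 17`: `1² + 8² + 3 = 68 = 4·17`. -/
theorem negThreeAsSumOfTwoSquares_seventeen : negThreeAsSumOfTwoSquares 17 = (1, 8) := by decide +kernel

/-- `m_E` for `E = 153a1` (`[0,0,1,−3,2]`, III at 3, no 2-torsion: `t₂ = 0`; `deg φ = 8`) on `ℙ¹(𝔽₁₇) = Fin 18`; the six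
zeros are the two orbits stabilised by a unit of order 4 (weight 2, off the support). -/
def g153a : Fin 18 → ZI :=
  ![(0, 0), (0, 1), (1, 0), (1, 0), (0, 0), (1, 0), (0, -1), (0, 1), (-1, 0), (0, 0), (-1, 0), (-1, 0), (0, -1), (0, 0),
    (0, 1), (0, 0), (0, -1), (0, 0)]

/-- `m_E` for the twin `153d1` (`[0,0,1,−27,−61]`, III* at 3; `deg φ = 24`) `= conj m_{153a1}`. -/
def g153d : Fin 18 → ZI :=
  ![(0, 0), (0, -1), (1, 0), (1, 0), (0, 0), (1, 0), (0, 1), (0, -1), (-1, 0), (0, 0), (-1, 0), (-1, 0), (0, 1), (0, 0),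
    (0, -1), (0, 0), (0, 1), (0, 0)]

/-- θ₄-equivariance, `W g = g` (the weight-2 points carry `g = 0`), `T₁₂,₂ g = 12·(−2)·g` (`a₂(153a1) = −2`),
`6⟨m,m⟩ = 12`, and the LAW at 153a1 / 153d1: `3 · 2⁰ · 8 = 24 = 2 · 3⁰ · 12`, `3 · 2⁰ · 24 = 72 = 2 · 3¹ · 12`. -/
theorem g153a_certificates : IsThetaFourEquivariant 17 g153a ∧ (∀ x : Fin 18, weightMul3 17 g153a x = g153a x) ∧
    (∀ x : Fin 18, thetaFourHecke12 17 2 g153a x = (12 * (-2) * (g153a x).1, 12 * (-2) * (g153a x).2)) ∧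
    thetaFourHeightSix 17 g153a = 12 ∧ (∀ x : Fin 18, g153d x = ZI.conj (g153a x)) ∧
    (3 * 2 ^ 0 * 8 : ℤ) = 2 * 3 ^ 0 * 12 ∧ (3 * 2 ^ 0 * 24 : ℤ) = 2 * 3 ^ 1 * 12 := by
  unfold IsThetaFourEquivariant
  refine ⟨?_, ?_, ?_, ?_, ?_, ?_, ?_⟩ <;> decide +kernel

/-- the sign at `p = 17`: `ζ(153a1) = +i`, `ζ(153d1) = −i` (`s₃ = −1`). -/
theorem g153_iota : (∀ x : Fin 18, thetaFourIota 17 g153a x = ZI.mul (0, 1) (g153a x)) ∧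
    (∀ x : Fin 18, thetaFourIota 17 g153d x = ZI.mul (0, -1) (g153d x)) := by
  constructor <;> decide +kernel


/-! ### §5. The `Iₙ*` stratum: the `θ₄² = η₃ ∘ Nrd` module (trivial on units, `χ₋₃`-twisted Hecke operators) and row
E-desc-124 -/

/-- UNIT-INVARIANCE (`θ₄²`-equivariance: `θ₄²(u) = 1` for every unit): `g(u·x) = g(x)` — `𝓜_{θ₄²}(p)` is the plain Brandt
module of the maximal order of `B_{3,∞}` at level `p` (forms of level `3p`, new at 3), to be used with the TWISTED Hecke
operators below; stabiliser weights `w(x) ∈ {1, 2, 3, 6}`. [folklore] -/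
def IsUnitInvariant3 (p : ℕ) (g : Fin (p + 1) → ZI) : Prop :=
  ∀ u ∈ dicyclicUnits, ∀ x : Fin (p + 1), g (act3 p u x) = g x

/-- `12 · T_ℓ^{θ₄²}`: `Σ_{Nrd γ = ℓ} θ₄(γ)² f(γ·x) = χ₋₃(ℓ) · (12 T_ℓ f)(x)` (`θ₄² = η₃ ∘ Nrd`), so a `θ₄²`-eigenfunction for
`(a_ℓ(E))` is a plain Brandt eigenfunction for `(χ₋₃(ℓ) a_ℓ(E)) = (a_ℓ(E ⊗ χ₋₃))`, `E ⊗ χ₋₃` multiplicative at 3. [folklore] -/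
def thetaFourSqHecke12 (p ℓ : ℕ) (f : Fin (p + 1) → ZI) (x : Fin (p + 1)) : ZI :=
  ((dicyclicOfNorm ℓ).map fun γ => ZI.iPowMul (2 * theta4Exp γ) (f (act3 p γ x))).foldr ZI.add (0, 0)

/-- `W g` is a `θ₄²`-Hecke eigenfunction for `a`: `T₁₂,ℓ^{θ₄²} (W g) = 12 a_ℓ · W g` for every prime `ℓ ∤ 3p`. [folklore] -/
def IsThetaFourSqHeckeEigen (p : ℕ) (g : Fin (p + 1) → ZI) (a : ℕ → ℤ) : Prop :=
  ∀ ℓ : ℕ, ℓ.Prime → ℓ ≠ 3 → ℓ ≠ p → ∀ x : Fin (p + 1),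
    thetaFourSqHecke12 p ℓ (weightMul3 p g) x = (12 * a ℓ * (weightMul3 p g x).1, 12 * a ℓ * (weightMul3 p g x).2)

open scoped Classical in
/-- **Row E-desc-124 `ThetaFourSqBrandtDegreeLawAtNinePrime` (LAW with an Eisenstein square; cell bsd-f2-manin, desc g18,
MEMO-desc §39.6; nothing asserted).**  For the `X₀(N)`-optimal curve of conductor `N = 9p` (`p ≥ 5` prime) of Kodaira type
`Iₙ*` at 3, `n = −v₃(j) ≥ 1`, and a primitive unit-invariant `g : ℙ¹(𝔽_p) → ℤ[i]` with `W g` a `θ₄²`-Hecke eigenfunction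
for `(a_ℓ(E))`:  `m² · deg φ = 8 · n · ⟨m_E, m_E⟩` for some `m ∈ {1, …, 5}` — cleared: `3 m² deg φ = 4 n · (6⟨m_E,m_E⟩)`.
Census (all `M ≤ 1111`, not only prime): 971 / 971 optimal `Iₙ*` curves with `9 ∥ N ≤ 9999`, `(N/9, 6) = 1` (one further
curve, 6435f1, has a rank-5 system not separated by seven `T_ℓ`); `m = 1` on 917 of them, INCLUDING ALL 535 curves with no
non-trivial rational isogeny; `m ∈ {2, 4}` only with rational 2-torsion structure (36), `m = 3` only with a rational 3-isogeny
(17), `m = 5` only with a rational 5-isogeny (3: 171c1, 225d1, 1611h1); prime level: 206 / 206 (`m = 1`: 172).  Reading: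
`E ⊗ χ₋₃` is multiplicative at 3 with `#Φ₃ = n` and the same Brandt vector (twisted eigenvalues), so this is Takahashi's
`deg φ · (Eisenstein) = ⟨e, e⟩ · #Φ₃` at the ramified prime of `B_{3,∞}` transported through the `χ₋₃`-twist `3p ↦ 9p`
(factor 8).  Why it might fail: an `Iₙ*` optimal curve with `m ∉ {1,…,5}` (a rational 7- or 13-isogeny class at prime level
`9p`; the two 13-isogeny curves of the census, 441e1 and 441f1 at `M = 49`, have `m = 1`) or with `8 n ξ / deg φ` not a square.
[cite: CremonaEcdata] [cite: Takahashi2001, Thm. 2.3 (tree `takahashi2001_thm_2_3_of_coprime`: Eichler level, the component group at a prime where the quaternion algebra ramifies — shape; the χ₋₃-transport to Iₙ* and the factor 8 are the cell's row E-desc-124, NOT in print)] -/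
@[conjecture]
def ThetaFourSqBrandtDegreeLawAtNinePrime : Prop :=
  ∀ (p : ℕ), p.Prime → 5 ≤ p →
  ∀ (W : WeierstrassCurve ℚ) [W.IsElliptic] [W.IsGloballyMinimal] [NeZero (W.conductorNorm ℤ)]
    (D : ModularParametrizationData W (W.conductorNorm ℤ)),
    W.conductorNorm ℤ = 9 * p →
    (∀ z ∈ D.L.lattice, ∃ w ∈ periodLattice D.f, z = D.c * w) →
    (∀ (W' : WeierstrassCurve ℚ) [W'.IsElliptic]
        (D' : ModularParametrizationData W' (W.conductorNorm ℤ)),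
        D'.f = D.f → D.modularDegree ≤ D'.modularDegree) →
    padicValRat 3 W.j < 0 →
  ∀ g : Fin (p + 1) → ZI,
    IsUnitInvariant3 p g → IsPrimitive3 p g → IsThetaFourSqHeckeEigen p g (fun n => W.LFunction n) →
    ∃ m : ℕ, 1 ≤ m ∧ m ≤ 5 ∧
      3 * (m : ℤ) ^ 2 * (D.modularDegree : ℤ) = 4 * (-padicValRat 3 W.j) * thetaFourHeightSix p g

/-- `m_E` for `E = 171d1` (`[0,0,1,−21,−41]`, `I₂*` at 3, `n = 2`, no rational isogeny; `deg φ = 32`) on `ℙ¹(𝔽₁₉) = Fin 20`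
in the `θ₄²`-module: unit-invariant, REAL, zero on the two weight-3 points; `a₂(E) = 2`, so the twisted operator has
`T₁₂,₂^{θ₄²} (W g) = 24 · W g`; `6⟨m,m⟩ = 12`; LAW: `3 · 1² · 32 = 96 = 4 · 2 · 12` (`m = 1`). -/
def g171d : Fin 20 → ZI :=
  ![(0, 0), (0, 0), (-1, 0), (-1, 0), (0, 0), (0, 0), (-1, 0), (-1, 0), (-1, 0), (-1, 0), (1, 0), (1, 0), (1, 0), (1, 0),
    (0, 0), (0, 0), (1, 0), (1, 0), (0, 0), (0, 0)]

/-- the embedding datum at `p = 19`: `0² + 4² + 3 = 19`. -/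
theorem negThreeAsSumOfTwoSquares_nineteen : negThreeAsSumOfTwoSquares 19 = (0, 4) := by decide +kernel

/-- kernel certificates for 171d1: unit-invariance, `W g = g` off the weight-3 zeros, `T₁₂,₂^{θ₄²}(W g) = 12·2·(W g)`,
`6⟨m,m⟩ = 12`, and the LAW instance `3·1²·32 = 4·2·12`. -/
theorem g171d_certificates : IsUnitInvariant3 19 g171d ∧ (∀ x : Fin 20, weightMul3 19 g171d x = g171d x) ∧
    (∀ x : Fin 20, thetaFourSqHecke12 19 2 g171d x = (12 * 2 * (g171d x).1, 12 * 2 * (g171d x).2)) ∧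
    thetaFourHeightSix 19 g171d = 12 ∧ (3 * (1 : ℤ) ^ 2 * 32 = 4 * 2 * 12) := by
  unfold IsUnitInvariant3
  refine ⟨?_, ?_, ?_, ?_, ?_⟩ <;> decide +kernel

/-- `m_E` for `E = 99b1` (`[1,−1,1,−59,186]`, `I₃*` at 3, `n = 3`, `E(ℚ)_tors = ℤ/4`; `deg φ = 12`) on `Fin 12` in the
`θ₄²`-module: `a₂(E) = −1`; `6⟨m,m⟩ = 12`; LAW with the Eisenstein square `m = 2`: `3 · 2² · 12 = 144 = 4 · 3 · 12`. -/
def g99b : Fin 12 → ZI :=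
  ![(-1, 0), (1, 0), (1, 0), (-1, 0), (1, 0), (1, 0), (-1, 0), (-1, 0), (1, 0), (-1, 0), (1, 0), (-1, 0)]

/-- kernel certificates for 99b1 (`m = 2`). -/
theorem g99b_certificates : IsUnitInvariant3 11 g99b ∧ (∀ x : Fin 12, weightMul3 11 g99b x = g99b x) ∧
    (∀ x : Fin 12, thetaFourSqHecke12 11 2 g99b x = (12 * (-1) * (g99b x).1, 12 * (-1) * (g99b x).2)) ∧
    (∀ x : Fin 12, thetaFourSqHecke12 11 5 g99b x = (12 * 2 * (g99b x).1, 12 * 2 * (g99b x).2)) ∧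
    thetaFourHeightSix 11 g99b = 12 ∧ (3 * (2 : ℤ) ^ 2 * 12 = 4 * 3 * 12) := by
  unfold IsUnitInvariant3
  refine ⟨?_, ?_, ?_, ?_, ?_, ?_⟩ <;> decide +kernel

end Summit.BirchSwinnertonDyer.Rank1Residual.ManinAdditive.ThetaFourBrandt
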